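import Mathlib.RingTheory.GradedAlgebra.Radical
import Mathlib.RingTheory.Localization.AtPrime.Basic
import Mathlib.RingTheory.Regular.RegularSequence
import Mathlib.RingTheory.KrullDimension.Basic
import Mathlib.RingTheory.Noetherian.Basic
import Mathlib.Algebra.CharP.Defs
import HarnessLib

/-!
# Cohen–Macaulay F-injectivity passes from the graded core `P*` to `P` (Hashimoto 2010, Cor. 5.2) — named fact

Topic: `Literature/RingTheory/TightClosure` (F-singularities: companion of `CMFIDeforms.lean`, `FInjectiveDeformation.lean`).
M. Hashimoto, *F-pure homomorphisms, strong F-regularity, and F-injectivity*, Comm. Algebra 38 (2010) 4569–4596 =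
arXiv:0908.2703; held text `paper:arxiv-0908.2703`, p0019 (§5, the graded consequences of the equivariant Matijevic–Roberts
theorem 5.1):

  *«Corollary 5.2. Let `p` be a prime number, and `A` a `ℤⁿ`-graded noetherian ring of characteristic `p`. Let `P` be a
  prime ideal of `A`, and `P*` be the prime ideal of `A` generated by the homogeneous elements of `P`. If `A_{P*}` is
  `F`-pure (resp. excellent strongly `F`-regular, CMFI), then `A_P` is `F`-pure (resp. strongly `F`-regular, CMFI).»*
  *«Corollary 5.3. Let `A` be a `ℤⁿ`-graded noetherian ring of characteristic `p`. If `A_𝔪` is `F`-pure (resp. excellent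
  strongly `F`-regular, CMFI) for any maximal graded ideals …, then `A` is `F`-pure (resp. strongly `F`-regular,
  Cohen–Macaulay `F`-injective).»*

We vendor the CMFI case of Cor. 5.2 for `ℕ`-GRADED rings (`n = 1`, non-negative grading — the case consumed by the
`FInjectiveMacaulayfication` crux: the associated graded ring `G(F) = ⊕ Iₙ/Iₙ₊₁` of a filtration, THEOREM-D / THEOREM-Q programme,
`cmfiCl_of_vertex`), with `P*` = Mathlib's `Ideal.homogeneousCore 𝒜 P` (the largest homogeneous ideal contained in `P`; prime by
`Ideal.IsPrime.homogeneousCore`, taken here as an instance binder). «CMFI» (Cohen–Macaulay and `F`-injective local ring) is rendered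
in the tree's vocabulary (Mathlib has neither predicate): every system of parameters is a weakly regular sequence (Cohen–Macaulay,
Matsumura Thm. 17.4 (iii)) AND every parameter ideal is Frobenius closed — for Cohen–Macaulay local rings this is F-injectivity
(Fedder 1983; Quy–Shimomoto 2017 Cor. 3.9), the reading used throughout the crux files (`SliceableCentre.CMCl` ∧ `FCl`).

* `Hashimoto2010_cmfi_of_homogeneousCore` — the named fact; users take `(h : Hashimoto2010_cmfi_of_homogeneousCore)`.

## References

* [Hashimoto2010] M. Hashimoto, Comm. Algebra 38 (2010), Cor. 5.2 and Cor. 5.3 (arXiv:0908.2703, p. 19), via Thm. 5.1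
  (equivariant Matijevic–Roberts).
* [QuyShimomoto2017] P. H. Quy, K. Shimomoto, Cor. 3.9 (CM: F-injective ⟺ parameter ideals Frobenius closed).
-/

noncomputable section

namespace Literature.RingTheory.TightClosure

universe u

/-- NAMED FACT — **Hashimoto 2010, Cor. 5.2 (CMFI case, `ℕ`-graded special case of the printed `ℤⁿ`-graded statement)**:
*«Let `A` be a `ℤⁿ`-graded noetherian ring of characteristic `p`, `P` a prime ideal of `A`, and `P*` the prime ideal generated
by the homogeneous elements of `P`. If `A_{P*}` is CMFI, then `A_P` is CMFI.»* Rendering: `A` an `ℕ`-graded (`GradedRing 𝒜`)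
Noetherian ring of prime characteristic `p`, `P` prime, `P* = (Ideal.homogeneousCore 𝒜 P).toIdeal` (prime — supplied as an
instance binder); CMFI at a local ring `L` := (every system of parameters of `L` — `d = dim L` elements generating an ideal with
maximal radical — is a weakly regular sequence) ∧ (every such parameter ideal is Frobenius closed for the exponent base `p`).
-- TODO(general form): `ℤⁿ`-gradings; the F-pure and (excellent) strongly F-regular variants; Cor. 5.3 (CMFI at the
-- graded-maximal ideals ⇒ CMFI everywhere) and Cor. 5.4/5.5 (deformation along a homogeneous non-zero-divisor / a filtration).
[cite: Hashimoto2010, Cor. 5.2; Cor. 5.3] -/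
def Hashimoto2010_cmfi_of_homogeneousCore : Prop :=
  ∀ (p : ℕ) [Fact p.Prime] (A : Type u) [CommRing A] [IsNoetherianRing A] [CharP A p]
    (𝒜 : ℕ → AddSubgroup A) [GradedRing 𝒜] (P : Ideal A) [P.IsPrime] [(P.homogeneousCore 𝒜).toIdeal.IsPrime],
    ((∀ d : ℕ, ringKrullDim (Localization.AtPrime (P.homogeneousCore 𝒜).toIdeal) = d →
        ∀ s : Fin d → Localization.AtPrime (P.homogeneousCore 𝒜).toIdeal, (Ideal.span (Set.range s)).radical.IsMaximal →
          RingTheory.Sequence.IsWeaklyRegular (Localization.AtPrime (P.homogeneousCore 𝒜).toIdeal) (List.ofFn s)) ∧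
      (∀ d : ℕ, ringKrullDim (Localization.AtPrime (P.homogeneousCore 𝒜).toIdeal) = d →
        ∀ s : Fin d → Localization.AtPrime (P.homogeneousCore 𝒜).toIdeal, (Ideal.span (Set.range s)).radical.IsMaximal →
          ∀ y : Localization.AtPrime (P.homogeneousCore 𝒜).toIdeal,
            (∃ e : ℕ, y ^ p ^ e ∈ Ideal.span ((fun z : Localization.AtPrime (P.homogeneousCore 𝒜).toIdeal => z ^ p ^ e) ''
              (Ideal.span (Set.range s) : Set (Localization.AtPrime (P.homogeneousCore 𝒜).toIdeal)))) →
            y ∈ Ideal.span (Set.range s))) →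
    ((∀ d : ℕ, ringKrullDim (Localization.AtPrime P) = d →
        ∀ s : Fin d → Localization.AtPrime P, (Ideal.span (Set.range s)).radical.IsMaximal →
          RingTheory.Sequence.IsWeaklyRegular (Localization.AtPrime P) (List.ofFn s)) ∧
      (∀ d : ℕ, ringKrullDim (Localization.AtPrime P) = d →
        ∀ s : Fin d → Localization.AtPrime P, (Ideal.span (Set.range s)).radical.IsMaximal →
          ∀ y : Localization.AtPrime P,
            (∃ e : ℕ, y ^ p ^ e ∈ Ideal.span ((fun z : Localization.AtPrime P => z ^ p ^ e) ''
              (Ideal.span (Set.range s) : Set (Localization.AtPrime P)))) →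
            y ∈ Ideal.span (Set.range s)))

end Literature.RingTheory.TightClosure

end
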